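import Summits.Ventures.CertifiedManyBodySolver.Observables.PhaseSeparationExclusionParticleHole
import Summits.Ventures.CertifiedManyBodySolver.Observables.PhaseSeparationExclusionBoxLayeredTcap
import HarnessLib

/-!
# Ventures/CertifiedManyBodySolver — Observables/PhaseSeparationExclusionParticleHoleLayered.lean: the particle–hole transport of the
# competing-order words, PART 4 — THE `c` AXIS (interlayer coupling): the `T = 0` layered-crystal column law REFLECTED to the electron-doped side

HONEST FRAMING: first certified bounds; not a superconductivity verdict. CLASS = TRANSPORT (generic, sorry-free; no claim node, no number, no definition).
Companion of `PhaseSeparationExclusionParticleHole{,Columns,Zeeman}.lean` (g28). The tree's layered law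
`IsTranslationInvariant.layeredGroundEnergy_lt_meanEnergy_mix_of_cap_lt_floors_of_cost_le` (`HubbardTTPrimePhaseCoexistenceExclusionLayered`, this seat g21) takes the 2D
bundle of the IN-PLANE model `Φ(t, s, U)` — cap at the mean density, floors at `n₁, n₂` (any densities `< 2`) — and the DENSITY-INDEPENDENT kinematic interlayer
cost `(4/π)Σ_b|tz_b| ≤ k`, and excludes the `(≤ n₁ ∣ ≥ n₂)` mixtures among the ground states of the 3D layered crystal `layeredHubbardTTPrime t s U w tz`. Under
`(t′, n) ↦ (−t′, 2 − n)` the 2D bundle transports with the affine terms of `energyDensityTT'_particleHole` (`reflected_cap`, `reflected_floor`), the margin is invariant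
and the cost `k` does not see the density at all. Hence:
* `psL_not_layeredGroundState_mix_on_cell_of_columns_tcap_reflected` — hypotheses EXACTLY as `psL_not_layeredGroundState_mix_on_cell_of_columns_tcap` with
  `0 < n₁` (stacking `w, tz` with `(4/π)Σ|tz| ≤ k`; source cell `[s₁, s₂] × [U₁, U₂]` of 2D data; column margins after the cost positive), conclusion: at every
  `(s, U)` of the MIRRORED cell `[−s₂, −s₁] × [U₁, U₂]` no mixture of translation-invariant states on `ℤ³` with `0 < ρ(ω₁) ≤ 2 − n₂`, `2 − n₁ ≤ ρ(ω₂) < 2` is a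
  ground state of `layeredHubbardTTPrime t s U w tz` at its filling.
NOTE: this is a statement about the 3D crystal built on the REFLECTED in-plane model; no particle–hole map of the 3D crystal is used or claimed (for a
non-bipartite stacking none flips only `t′`) — the transport acts on the 2D INPUTS, the layered law does the rest. Instances:
`Observables/PhaseSeparationExclusionElectronDopedMirrorLayered.lean`. NOT done: the `T > 0` layered form. Cell `pub/hubbard-downfold` (MO-S1 ↔ S2 seam,
filling direction; D-0096 (iii) interlayer coupling × competing orders), seat `hubbard-downfold-unc-2` (g28), 2026-08-29. Zero kit.
References: [cite: LiebWuPhysicaA2003, §1 eq. (3)]; [cite: Israel1979, Thm. I.2.4]; [cite: BratteliKishimotoRobinson1978, Thm. 2 (condition 2)];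
[cite: PavariniEtAl2001, eq. (1)]; [cite: EmeryKivelsonLin1990, pp. 475–476].
-/

noncomputable section

namespace Summit.Ventures.CertifiedManyBodySolver.Observables

open Literature.MathematicalPhysics.QuantumLattice Literature.MathematicalPhysics.QuantumLattice.ThermodynamicLimit
open Literature.MathematicalPhysics.QuantumLattice.InfVolFermionState Set Filter
open Literature.Probability.LatticeModels HubbardWave0
open scoped BigOperators

/-- **LAYERED-CRYSTAL PS EXCLUSION ON THE MIRRORED CELL, `T = 0`, COLUMN FORM, CAP AFFINE IN `(s, U)`.** Hypotheses exactly as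
`psL_not_layeredGroundState_mix_on_cell_of_columns_tcap` with `0 < n₁` (stacking vectors `w_b` with `(w_b)₀ ≠ 0` inside `thicken {0} R'`, hoppings `tz_b`,
`(4/π)Σ_b|tz_b| ≤ k`; 2D data on the source cell `[s₁, s₂] × [U₁, U₂]`, `0 ≤ U₁ < U₂`: cap `c₀ + c_s s + c₁ U` at `an₁ + bn₂`, column laws at `n₂`, dilute floor
`F₁(s)`; both column margins after the cost `k` positive). THEN for every `(s, U)` of the MIRRORED cell `[−s₂, −s₁] × [U₁, U₂]` no mixture `λω₁ + (1−λ)ω₂`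
(`0 < λ < 1`) of translation-invariant states on `ℤ³` with `0 < ρ(ω₁) ≤ 2 − n₂`, `2 − n₁ ≤ ρ(ω₂) < 2` is a ground state of `layeredHubbardTTPrime t s U w tz` at its
filling. [cite: LiebWuPhysicaA2003, §1 eq. (3)] [cite: Israel1979, Thm. I.2.4] [cite: BratteliKishimotoRobinson1978, Thm. 2 (condition 2)] -/
theorem psL_not_layeredGroundState_mix_on_cell_of_columns_tcap_reflected (t : ℝ) {κ : Type*} [Fintype κ] {w : κ → Site 3}
    (hw : ∀ b, w b 0 ≠ 0) (tz : κ → ℝ) {R' : ℝ} (hR' : 1 ≤ R') (hwR' : ∀ b, w b ∈ thicken ({0} : Finset (Site 3)) R')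
    {s₁ s₂ U₁ U₂ n₁ n₂ a b c₀ cs c₁ k : ℝ} (hU₁ : 0 ≤ U₁) (h12 : U₁ < U₂) (hn₁ : 0 < n₁) (hn : n₁ < n₂) (hn₂ : n₂ < 2)
    (ha : 0 ≤ a) (hb : 0 ≤ b) (hab : a + b = 1) {L₁ L₂ F₁ : ℝ → ℝ}
    (hC : ∀ s ∈ Icc s₁ s₂, ∀ U ∈ Icc U₁ U₂, energyDensityTT' t s U (a * n₁ + b * n₂) ≤ c₀ + cs * s + c₁ * U)
    (hL₁ : ∀ s ∈ Icc s₁ s₂, L₁ s ≤ energyDensityTT' t s U₁ n₂) (hL₂ : ∀ s ∈ Icc s₁ s₂, L₂ s ≤ energyDensityTT' t s U₂ n₂)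
    (hF₁ : ∀ s ∈ Icc s₁ s₂, ∀ U ∈ Icc U₁ U₂, F₁ s ≤ energyDensityTT' t s U n₁)
    (hk : 4 / Real.pi * ∑ b, |tz b| ≤ k)
    (hm₁ : ∀ s ∈ Icc s₁ s₂, c₀ + cs * s + c₁ * U₁ + k < a * F₁ s + b * L₁ s)
    (hm₂ : ∀ s ∈ Icc s₁ s₂, c₀ + cs * s + c₁ * U₂ + k < a * F₁ s + b * L₂ s)
    {s : ℝ} (hs : s ∈ Icc (-s₂) (-s₁)) {U : ℝ} (hU : U ∈ Icc U₁ U₂)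
    {ω₁ ω₂ : InfVolFermionState 3} (h₁ : ω₁.IsTranslationInvariant) (h₂ : ω₂.IsTranslationInvariant)
    (hρ₁ : 0 < ω₁.density) (hρ₁' : ω₁.density ≤ 2 - n₂) (hρ₂ : 2 - n₁ ≤ ω₂.density) (hρ₂' : ω₂.density < 2)
    {lam : ℝ} (hl0 : 0 < lam) (hl1 : lam < 1) :
    (layeredHubbardTTPrime t s U w tz).tiGroundEnergyDensityAt R' (mix lam hl0.le hl1.le ω₁ ω₂).density <
      (mix lam hl0.le hl1.le ω₁ ω₂).meanEnergy (layeredHubbardTTPrime t s U w tz) R' := by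
  have hn2' : 0 ≤ n₂ := hn₁.le.trans hn.le
  have hm0 : 0 < a * n₁ + b * n₂ := by nlinarith
  have hm2 : a * n₁ + b * n₂ < 2 := by nlinarith
  have hs' : -s ∈ Icc s₁ s₂ := neg_mem_Icc_of_mem_Icc_neg hs
  have hUU : 0 ≤ U := hU₁.trans hU.1
  -- the reflected 2D bundle at the target point `(s, U)`
  have hcap : energyDensityTT' t s U (b * (2 - n₂) + a * (2 - n₁)) ≤
      c₀ + cs * (-s) + c₁ * U + U * (b * (2 - n₂) + a * (2 - n₁) - 1) :=
    reflected_cap t hU₁ hab hm0 hm2 (C := fun s U => c₀ + cs * s + c₁ * U) hC s hs U hU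
  have hfl₂ : ((U₂ - U) * L₁ (-s) + (U - U₁) * L₂ (-s)) / (U₂ - U₁) + U * (1 - n₂) ≤ energyDensityTT' t s U (2 - n₂) :=
    reflected_floor t hU₁ (hn₁.trans hn) hn₂ (F := fun s U => ((U₂ - U) * L₁ s + (U - U₁) * L₂ s) / (U₂ - U₁))
      (floor_on_cell_of_columnLaws t hn2' hn₂ hU₁ h12 hL₁ hL₂) s hs U hU
  have hfl₁ : F₁ (-s) + U * (1 - n₁) ≤ energyDensityTT' t s U (2 - n₁) :=
    reflected_floor t hU₁ hn₁ (hn.trans hn₂) (F := fun s _ => F₁ s) hF₁ s hs U hU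
  refine h₁.layeredGroundEnergy_lt_meanEnergy_mix_of_cap_lt_floors_of_cost_le t s hUU hw tz hR' hwR' h₂ hρ₁ hρ₂' hρ₁' (by linarith) hρ₂
    hb ha (by linarith) hcap hfl₂ hfl₁ hk ?_ hl0 hl1
  -- the source margin at `(-s, U)` beats the cost (U-chord of the two column margins)
  have hpos := uchord_pos_of_ends h12 hU (sub_pos.2 (hm₁ (-s) hs')) (sub_pos.2 (hm₂ (-s) hs'))
  have hd : (U₂ - U₁) ≠ 0 := (sub_pos.2 h12).ne'
  have hid : a * F₁ (-s) + b * (((U₂ - U) * L₁ (-s) + (U - U₁) * L₂ (-s)) / (U₂ - U₁)) - (c₀ + cs * (-s) + c₁ * U + k) =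
      ((U₂ - U) * (a * F₁ (-s) + b * L₁ (-s) - (c₀ + cs * (-s) + c₁ * U₁ + k)) +
        (U - U₁) * (a * F₁ (-s) + b * L₂ (-s) - (c₀ + cs * (-s) + c₁ * U₂ + k))) / (U₂ - U₁) := by
    field_simp
    ring
  have hsrc := hid ▸ hpos
  have hb1 : b = 1 - a := by linarith
  subst hb1
  linarith

end Summit.Ventures.CertifiedManyBodySolver.Observables

end
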